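import Literature.NumberTheory.EllipticCurves.ZpExtensionScalarTwistMaps
import Literature.NumberTheory.GaloisRepresentations.LocalGlobalCohomology
import HarnessLib

/-!
# Howard's compact cohomology `H¹(K, T_𝔮) = lim_k H¹(K, T_𝔮/p^k T_𝔮)` at an Eisenstein prime `𝔮 = (T^m + p)`,
# as a PINNED `Λ`-module (hypothesis structure `ZpExtension.EisensteinH1Data`), and its Selmer part
# (definitions with bodies + unfolding lemmas; no named fact, no instance on existing types, no notation)

Topic `NumberTheory/EllipticCurves` (companion of `ZpExtensionScalarTwist`, `ZpExtensionScalarTwistMaps`; the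
`𝔮`-adic twin of `WeierstrassCurve.LambdaAdicSelmerData` of `HeegnerModuleIndex`).

Howard [Howard 2004, §2.2, Def. 2.2.3; proof of Thm. 2.2.10 "taking `𝔮 = T^m + p`"]: for the `Λ`-adic module
`𝐓 = T_p(E) ⊗ Λ` and a height-one prime `𝔮` of `Λ`, `T_𝔮 = 𝐓 ⊗_Λ S_𝔮` (`S_𝔮 = Λ/𝔮`) is a compact
`S_𝔮[Γ_K]`-module, `T_𝔮 = lim_k T_𝔮/p^k T_𝔮`, and its continuous cohomology is
`H¹(K, T_𝔮) = lim_k H¹(K, T_𝔮/p^k T_𝔮)` (finite coefficient modules; Tate, Serre II §1), an `S_𝔮`-module through the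
coefficient action. In the tree the finite levels are the discrete Galois modules
`κ.eisensteinTwist (ρ k) hm k` on `IwasawaAlgebra.EisensteinCoeff.Twisted p m k (M k)` (`= M_k ⊗ A_{m,k}(ψ)`,
`A_{m,k} = Λ/(q_m, p^k)`; for `M_k = E[p^k]`: `T_𝔮/p^k T_𝔮`), the coefficient action is the intertwining map
`κ.eisensteinTwistSMulHom`, and the transition `T_𝔮/p^{k+1} → T_𝔮/p^k` is `κ.eisensteinTwistReduce hm _ (t k)`
along a morphism `t k : M_{k+1} → M_k` (for `E`: `P ↦ p P`, `WeierstrassCurve.torsionMulBy`). As for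
`LambdaAdicSelmerData`, we do NOT build the limit; we PIN it:

* `ZpExtension.EisensteinH1Data κ ρ t hm` — an abstract `Λ`-module `H` with additive projections
  `proj k : H → H¹(K, M_k ⊗ A_{m,k}(ψ))` (the tree's `galoisCohomology … 1`) such that: `Λ` acts through the
  coefficient action (`proj_smul`: `proj k (f • h) = H¹(· ↦ [f] • ·) (proj k h)`), the projections are
  compatible with the reductions (`proj_reduce`), jointly injective (`ext`), and every compatible family of
  classes comes from `H` (`surj`). Any two such data are canonically isomorphic (not proved here); for the
  intended `E`-instance `H = H¹(K, T_𝔮)`.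
  SIGN CONVENTION (cell `pub/bsd-print-x9`, x10b-p1-w2 g6 / lead g5, 2026-08-28): to make the control map
  `𝔖 = lim H¹(K_n, E[p^k]) → H` `Λ`-LINEAR for `LambdaAdicSelmerData.proj_X` (`T ↦ conj_γ − 1`) one
  instantiates at the inverse extension `κ.unitTwist (-1)` (same layers; `ψ(γ) = (1+T)⁻¹`); the structure is
  stated for an arbitrary `κ`.
* `EisensteinH1Data.selmerAddSubgroup D 𝓕` — for a family of Selmer structures `𝓕 k` on the finite levels
  (the tree's `DiscreteGaloisModule.SelmerStructure`), the subgroup `{h | ∀ k, proj k h ∈ H¹_{𝓕 k}}` — Howard's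
  `H¹_{F_𝔮}(K, T_𝔮) = lim_k H¹_{F_𝔮}(K, T_𝔮/p^k)` once `F_𝔮` is supplied; `EisensteinH1Data.selmerSubmodule` —
  the same as a `Λ`-submodule when the local conditions are stable under the coefficient action (`h𝓕`).
* unfolding lemmas (`proj_injective`, `ext_iff'`, `smul_eq_smul_of_sub_mem_span_qm` — `H` is a module over
  `S_𝔮 = Λ/(q_m)` in all but name —, `mem_selmerAddSubgroup_iff`, `mem_selmerSubmodule_iff`). NOT here: the
  existence of such data (the limit construction needs the functoriality/additivity of `galoisCohomology.map`
  in the coefficients, not yet recorded in the tree); consumers take `(D : EisensteinH1Data …)` as a parameter,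
  as for `LambdaAdicSelmerData`.

Nothing here asserts anything about Selmer groups of elliptic curves; this is the CARRIER `H` (field `SpecWitness.H`
of `Summits/…/Theorems/PrintX9MuPartSpecWitnessDefs`) of the D1 road of the shared μ-residual of rows 9/10.
BSD is not proved by any of this.

References: [Howard2004HeegnerKolyvagin] B. Howard, Compositio Math. 140 (2004), §2.2, Def. 2.2.3, Lemma 2.2.7,
Prop. 2.2.8, proof of Thm. 2.2.10; [MazurRubinMemoirs2004] §5.3; [SerreGaloisCohomology1997] I §2.2, II §1;
[PerrinRiou1987BSMF] §0 p. 402 (the compact modules `lim S_p` as `Λ`-modules).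
-/

noncomputable section

open scoped TensorProduct Topology ContRepresentation
open Field Filter

universe u

namespace Literature.NumberTheory.EllipticCurves

open Literature.NumberTheory.GaloisRepresentations
open Literature.NumberTheory.GaloisRepresentations.DiscreteGaloisModule (SelmerStructure)

namespace ZpExtension

variable {K : Type u} [Field K] {p : ℕ} [hp : Fact p.Prime] (κ : ZpExtension K p)
  {M : ℕ → Type u} [∀ k, AddCommGroup (M k)] [∀ k, TopologicalSpace (M k)] [∀ k, DiscreteTopology (M k)]
  (ρ : ∀ k, DiscreteGaloisModule K (M k))
  (t : ∀ k, (ρ (k + 1)).toContRepresentation →ⁱL (ρ k).toContRepresentation) {m : ℕ} (hm : 1 ≤ m)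

/-- **Howard's `H¹(K, T_𝔮)` at the Eisenstein prime `𝔮 = (T^m + p)`, PINNED** (hypothesis structure, the
`𝔮`-adic twin of `WeierstrassCurve.LambdaAdicSelmerData`). For an inverse system `(M_k, t_k)` of discrete Galois
modules (intended: `M_k = E[p^k]`, `t_k = (P ↦ p P)`), a term packages an abstract `Λ = ℤ_p⟦T⟧`-module `H`
(intended: `lim_k H¹(K, M_k ⊗ A_{m,k}(ψ)) = H¹(K, T_𝔮)`, an `S_𝔮 = Λ/𝔮`-module) with additive projections
`proj k : H → H¹(K, M_k ⊗ A_{m,k}(ψ))` and the identities pinning everything down: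
* `proj_smul`: `f ∈ Λ` acts through multiplication by its class in `A_{m,k}` on the coefficients
  (`galoisCohomology.map` of `eisensteinTwistSMulHom … [f]`);
* `proj_reduce`: compatibility with the reductions `M_{k+1} ⊗ A_{m,k+1}(ψ) → M_k ⊗ A_{m,k}(ψ)`
  (`eisensteinTwistReduce hm _ (t k)`);
* `ext`, `surj`: `h ↦ (proj k h)_k` is a bijection onto the compatible families.
[cite: Howard2004HeegnerKolyvagin, §2.2 and Def. 2.2.3 (H¹(K, T_𝔮) as an S_𝔮-module), proof of Thm. 2.2.10 (𝔮 = T^m + p)]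
[cite: SerreGaloisCohomology1997, I §2.2 and II §1 (cohomology with compact coefficients as a limit)] -/
structure EisensteinH1Data where
  /-- The underlying type of `H¹(K, T_𝔮)`. -/
  H : Type u
  /-- `H` is an abelian group. -/
  [addCommGroup : AddCommGroup H]
  /-- `H` is a `Λ = ℤ_p⟦T⟧`-module (an `S_𝔮`-module: `q_m` acts by zero, `proj_injective` + `eisensteinTwistSMulHom_qm`). -/
  [module : Module (IwasawaAlgebra p) H]
  /-- The projection to level `k`: `H → H¹(K, M_k ⊗ A_{m,k}(ψ))`. -/
  proj (k : ℕ) : H →+ galoisCohomology (κ.eisensteinTwist (ρ k) hm k) 1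
  /-- `f ∈ Λ` acts through the coefficient action of its class `[f] ∈ A_{m,k}`. -/
  proj_smul : ∀ (k : ℕ) (f : IwasawaAlgebra p) (h : H),
    proj k (f • h) =
      galoisCohomology.map (κ.eisensteinTwistSMulHom (ρ k) hm k (Ideal.Quotient.mk _ f)) 1 (proj k h)
  /-- Compatibility with the reductions `level k+1 → level k`. -/
  proj_reduce : ∀ (k : ℕ) (h : H),
    galoisCohomology.map (κ.eisensteinTwistReduce hm (Nat.le_succ k) (t k)) 1 (proj (k + 1) h) = proj k h
  /-- Joint injectivity of the projections. -/
  ext : ∀ h : H, (∀ k, proj k h = 0) → h = 0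
  /-- Every compatible family of classes comes from `H`. -/
  surj : ∀ x : (Π k : ℕ, galoisCohomology (κ.eisensteinTwist (ρ k) hm k) 1),
    (∀ k, galoisCohomology.map (κ.eisensteinTwistReduce hm (Nat.le_succ k) (t k)) 1 (x (k + 1)) = x k) →
    ∃ h : H, ∀ k, proj k h = x k

attribute [instance] EisensteinH1Data.addCommGroup EisensteinH1Data.module

namespace EisensteinH1Data

variable {κ ρ t hm} (D : EisensteinH1Data κ ρ t hm)

/-- The projections are jointly injective: `h` is determined by its components `(proj k h)_k`.
[cite: Howard2004HeegnerKolyvagin, §2.2 (T_𝔮 = lim T_𝔮/p^k T_𝔮)] -/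
theorem proj_injective : Function.Injective fun (h : D.H) (k : ℕ) ↦ D.proj k h := by
  intro h h' hh
  rw [← sub_eq_zero]
  refine D.ext _ fun k ↦ ?_
  rw [map_sub, sub_eq_zero]
  exact congrFun hh k

/-- Two elements agree iff all their projections agree. [cite: Howard2004HeegnerKolyvagin, §2.2] -/
theorem ext_iff' {h h' : D.H} : h = h' ↔ ∀ k, D.proj k h = D.proj k h' :=
  ⟨fun e k ↦ by rw [e], fun hh ↦ D.proj_injective (funext hh)⟩

/-- The action of `f ∈ Λ` depends only on the classes `[f] ∈ A_{m,k}`: if `f − g` lies in every `(q_m, p^k)`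
(e.g. `f − g ∈ (q_m)`), then `f • h = g • h`. In particular `H` is a `Λ/𝔮`-module in all but name.
[cite: Howard2004HeegnerKolyvagin, §2.2 and Def. 2.2.3 (H¹(K, T_𝔮) is an S_𝔮-module)] -/
theorem smul_eq_smul_of_forall_sub_mem {f g : IwasawaAlgebra p}
    (hfg : ∀ k, f - g ∈ Ideal.span {(PowerSeries.X ^ m + PowerSeries.C (p : ℤ_[p]) : IwasawaAlgebra p)} ⊔
      Ideal.span {PowerSeries.C ((p : ℤ_[p]) ^ k)}) (h : D.H) :
    f • h = g • h := by
  rw [D.ext_iff']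
  intro k
  rw [D.proj_smul, D.proj_smul, (Ideal.Quotient.eq.mpr (hfg k) :
    (Ideal.Quotient.mk _ f : IwasawaAlgebra.EisensteinCoeff p m k) = Ideal.Quotient.mk _ g)]

/-- `f • h = g • h` whenever `f ≡ g (mod q_m)`: `H` is a module over `S_𝔮 = Λ/(q_m)`.
[cite: Howard2004HeegnerKolyvagin, §2.2 and Def. 2.2.3 (H¹(K, T_𝔮) is an S_𝔮-module)] -/
theorem smul_eq_smul_of_sub_mem_span_qm {f g : IwasawaAlgebra p}
    (hfg : f - g ∈ Ideal.span {(PowerSeries.X ^ m + PowerSeries.C (p : ℤ_[p]) : IwasawaAlgebra p)}) (h : D.H) :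
    f • h = g • h :=
  D.smul_eq_smul_of_forall_sub_mem (fun _ ↦ Ideal.mem_sup_left hfg) h

section Selmer

variable [NumberField K] (𝓕 : ∀ k : ℕ, SelmerStructure (κ.eisensteinTwist (ρ k) hm k))

/-- **Howard's `H¹_{F_𝔮}(K, T_𝔮) = lim_k H¹_{F_𝔮}(K, T_𝔮/p^k T_𝔮)` inside the pinned `H¹(K, T_𝔮)`**, for a
family of Selmer structures `𝓕 k` on the finite levels (the tree's `SelmerStructure.selmerGroup`): the
subgroup of `h` all of whose projections are Selmer classes. The Selmer structure `F_𝔮` itself (ordinary /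
Kummer at `v ∣ p`, unramified at `v ∤ p`) is NOT defined here. [cite: Howard2004HeegnerKolyvagin, Def. 2.2.3 and Lemma 2.2.7 (the Selmer structure F_𝔮 on T_𝔮)]
[cite: MazurRubinMemoirs2004, §5.3] -/
def selmerAddSubgroup : AddSubgroup D.H :=
  ⨅ k : ℕ, ((𝓕 k).selmerGroup).comap (D.proj k)

/-- Membership in `selmerAddSubgroup`: all projections are Selmer classes. [cite: Howard2004HeegnerKolyvagin, Def. 2.2.3] -/
@[simp]
theorem mem_selmerAddSubgroup_iff (h : D.H) :
    h ∈ D.selmerAddSubgroup 𝓕 ↔ ∀ k, D.proj k h ∈ (𝓕 k).selmerGroup := by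
  simp [selmerAddSubgroup, AddSubgroup.mem_iInf]

/-- **`H¹_{F_𝔮}(K, T_𝔮)` as a `Λ`-SUBMODULE** when every Selmer group `H¹_{𝓕 k}` is stable under the coefficient
action of `A_{m,k}` (`h𝓕`; automatic when the local conditions are `A_{m,k}`-submodules, as Howard's are —
`F_𝔮` is a Selmer structure "of `S_𝔮`-modules"). [cite: Howard2004HeegnerKolyvagin, Def. 2.2.3 and §2.1 (Selmer structures on R-modules)]
[cite: MazurRubinMemoirs2004, §5.3] -/
def selmerSubmodule
    (h𝓕 : ∀ (k : ℕ) (c : IwasawaAlgebra.EisensteinCoeff p m k) (x : galoisCohomology (κ.eisensteinTwist (ρ k) hm k) 1),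
      x ∈ (𝓕 k).selmerGroup →
        galoisCohomology.map (κ.eisensteinTwistSMulHom (ρ k) hm k c) 1 x ∈ (𝓕 k).selmerGroup) :
    Submodule (IwasawaAlgebra p) D.H where
  carrier := D.selmerAddSubgroup 𝓕
  add_mem' ha hb := add_mem ha hb
  zero_mem' := zero_mem _
  smul_mem' f h hh := by
    have hh' : h ∈ D.selmerAddSubgroup 𝓕 := hh
    rw [mem_selmerAddSubgroup_iff] at hh'
    show f • h ∈ D.selmerAddSubgroup 𝓕
    rw [mem_selmerAddSubgroup_iff]
    intro k
    rw [D.proj_smul]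
    exact h𝓕 k _ _ (hh' k)

/-- Membership in `selmerSubmodule`: all projections are Selmer classes. [cite: Howard2004HeegnerKolyvagin, Def. 2.2.3] -/
@[simp]
theorem mem_selmerSubmodule_iff
    (h𝓕 : ∀ (k : ℕ) (c : IwasawaAlgebra.EisensteinCoeff p m k) (x : galoisCohomology (κ.eisensteinTwist (ρ k) hm k) 1),
      x ∈ (𝓕 k).selmerGroup →
        galoisCohomology.map (κ.eisensteinTwistSMulHom (ρ k) hm k c) 1 x ∈ (𝓕 k).selmerGroup) (h : D.H) :
    h ∈ D.selmerSubmodule 𝓕 h𝓕 ↔ ∀ k, D.proj k h ∈ (𝓕 k).selmerGroup :=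
  D.mem_selmerAddSubgroup_iff 𝓕 h

/-- The Selmer submodule's underlying subgroup is `selmerAddSubgroup`. [cite: Howard2004HeegnerKolyvagin, Def. 2.2.3] -/
theorem selmerSubmodule_toAddSubgroup
    (h𝓕 : ∀ (k : ℕ) (c : IwasawaAlgebra.EisensteinCoeff p m k) (x : galoisCohomology (κ.eisensteinTwist (ρ k) hm k) 1),
      x ∈ (𝓕 k).selmerGroup →
        galoisCohomology.map (κ.eisensteinTwistSMulHom (ρ k) hm k c) 1 x ∈ (𝓕 k).selmerGroup) :
    (D.selmerSubmodule 𝓕 h𝓕).toAddSubgroup = D.selmerAddSubgroup 𝓕 :=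
  rfl

end Selmer

end EisensteinH1Data

end ZpExtension

end Literature.NumberTheory.EllipticCurves

end
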